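import Literature.Probability.RandomPlanarGeometry.HexSAWBrickWallRowUnfoldingStep
import HarnessLib

/-!
# The Hammersley–Welsh unfolding ACROSS THE ROWS of the brick wall, II: the depth of a fold strictly decreases

Topic `Literature/Probability/RandomPlanarGeometry` (continues `HexSAWBrickWallRowUnfoldingStep.lean`: the fold
`HexBW.rowFold n ω` of an `n`-step honeycomb self-avoiding walk `ω` (brick-wall coordinates) that does not end on its top
row `m = maxRow n ω` — keep `ω[0, p−1]`, `p = lastTop n ω`, and continue with the reflection of `ω[p−1, n]` in the
half-integer row `m + ½`, one inserted vertical bond; `rowFold n ω ∈ HexBW.saws (n+1)`, injective given `m`).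
Source of the scheme: N. Madras, G. Slade, *The Self-Avoiding Walk* (1993), §3.1, proof of Proposition 3.1.5
(pp. 60–61: the spans `A₁(ω) > A₂(ω) > ⋯` of the successive pieces strictly decrease, so a walk is recovered from its
unfolding and a strictly decreasing sequence of positive integers of bounded sum); for the honeycomb lattice with
inserted edges N. R. Beaton, J. Phys. A 47 (2014) 075003, arXiv:1210.0274v3, p. 12.

## What this file proves (namespace `Literature.Probability.RandomPlanarGeometry.SAW.HexBW`)

The DEPTH of a fold is `depth n ω := maxRow n ω − min{ω(j)₁ : lastTop n ω − 1 ≤ j ≤ n}` (how far the folded tail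
dips below the old top row).  Then:
* `no_two_vertical` — two consecutive steps of a honeycomb self-avoiding walk are never both vertical (from an even
  site the vertical bond points up, from an odd site down); hence `row_sub_le`: in `s` steps the row drops by at most
  `⌈s/2⌉`;
* `maxRow_rowFold_eq` — the fold raises the top row by exactly `depth + 1`:
  `maxRow (n+1) (rowFold n ω) = maxRow n ω + 1 + depth n ω`, and `one_le_depth`;
* `lastTop_rowFold_ge` — the new last-top time is at least `lastTop n ω + 2·depth n ω`;
* **`depth_rowFold_lt`** — if the fold again does not end on its top row, its depth is STRICTLY smaller:
  `depth (n+1) (rowFold n ω) < depth n ω`.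
So along an iterated unfolding the depths form a strictly decreasing sequence of positive integers — the input of the
partition count `e^{O(√n)}` exactly as the spans do in Madras–Slade's proof; the iteration and the count are the sequel.
-/

noncomputable section

open Finset Function Literature.Probability.LatticeModels Literature.Probability.Percolation SimpleGraph

namespace Literature.Probability.RandomPlanarGeometry.SAW.HexBW

/-! ### No two consecutive vertical steps -/

/-- **Two consecutive steps of the brick wall with three distinct sites are never both vertical**: a vertical bond
joins an even site (below) to an odd site (above), so after a vertical step the next vertical bond leads back.
[cite: EntingJensen2009, §7.4.2, Fig. 7.10 (brickwork form of the honeycomb lattice)] -/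
theorem no_two_vertical {x y z : Site 2} (h1 : brickWallGraph.Adj x y) (h2 : brickWallGraph.Adj y z)
    (hzx : z ≠ x) (hv : y 0 = x 0) : z 0 ≠ y 0 := by
  intro hv2
  rw [brickWallGraph_adj_coord] at h1 h2
  apply hzx
  funext j
  fin_cases j
  · show z 0 = x 0; omega
  · show z 1 = x 1; omega

/-- Along a honeycomb self-avoiding walk the row drops by at most half a unit per step on average:
`2 (ω(t)₁ − ω(i)₁) ≤ i − t + 1` for `t ≤ i ≤ n` (descending `d` rows costs at least `2d − 1` steps).
[cite: MadrasSlade1993, §3.1 (proof of Proposition 3.1.5)] -/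
theorem two_mul_row_sub_le {n : ℕ} {ω : ℕ → Site 2} (hω : ω ∈ saws n) (t : ℕ) :
    ∀ i : ℕ, t ≤ i → i ≤ n → 2 * (ω t 1 - ω i 1) ≤ (i : ℤ) - t + 1 := by
  obtain ⟨-, -, hbw, hinj⟩ := mem_saws_iff.1 hω
  intro i
  induction i using Nat.strong_induction_on with
  | _ i ih =>
    intro hti hin
    rcases Nat.lt_or_ge t i with hlt | hge
    · -- the last step `i-1 → i`
      obtain ⟨k, rfl⟩ : ∃ k, i = k + 1 := ⟨i - 1, by omega⟩
      have hlast := hbw k (by omega)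
      by_cases hhor : ω (k + 1) 0 ≠ ω k 0
      · -- horizontal step: same row
        rw [brickWallGraph_adj_coord] at hlast
        have hrow : ω (k + 1) 1 = ω k 1 := by omega
        have := ih k (by omega) (by omega) (by omega)
        push_cast; omega
      · -- vertical step: drop ≤ 1, and the step before (if any) is horizontal
        push Not at hhor
        have hdrop : ω k 1 - ω (k + 1) 1 ≤ 1 := by
          rw [brickWallGraph_adj_coord] at hlast; omega
        rcases Nat.lt_or_ge t k with hlt' | hge'
        · obtain ⟨k', rfl⟩ : ∃ k', k = k' + 1 := ⟨k - 1, by omega⟩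
          have hprev := hbw k' (by omega)
          have hne : ω (k' + 1 + 1) ≠ ω k' := fun heq => by
            have := hinj (show k' + 1 + 1 ∈ {i | i ≤ n} by simp only [Set.mem_setOf_eq]; omega)
              (show k' ∈ {i | i ≤ n} by simp only [Set.mem_setOf_eq]; omega) heq
            omega
          -- the step `k' → k'+1` is horizontal (else two consecutive vertical steps)
          have hh : ω (k' + 1) 0 ≠ ω k' 0 := fun hv => no_two_vertical hprev hlast hne hv hhor
          rw [brickWallGraph_adj_coord] at hprev
          have hrow : ω (k' + 1) 1 = ω k' 1 := by omega
          have := ih k' (by omega) (by omega) (by omega)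
          push_cast; omega
        · have hk : k = t := by omega
          subst hk
          push_cast; omega
    · have : i = t := by omega
      subst this
      simp

/-! ### The depth of a fold -/

/-- The lowest row of `ω` on the folded segment `[lastTop n ω − 1, n]`. [cite: MadrasSlade1993, §3.1 (proof of Proposition 3.1.5)] -/
def tailMin (n : ℕ) (ω : ℕ → Site 2) : ℤ :=
  (Finset.Icc (lastTop n ω - 1) n).inf' ⟨n, Finset.mem_Icc.2 ⟨by have := (lastTop_spec n ω).1; omega, le_rfl⟩⟩
    fun j => ω j 1

/-- `tailMin ≤ ω j 1` on the folded segment. [cite: MadrasSlade1993, §3.1 (proof of Proposition 3.1.5, p. 58)] -/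
theorem tailMin_le {n : ℕ} (ω : ℕ → Site 2) {j : ℕ} (h1 : lastTop n ω - 1 ≤ j) (h2 : j ≤ n) : tailMin n ω ≤ ω j 1 :=
  Finset.inf'_le (fun j => ω j 1) (Finset.mem_Icc.2 ⟨h1, h2⟩)

/-- `tailMin` is attained on the folded segment. [cite: MadrasSlade1993, §3.1 (proof of Proposition 3.1.5, p. 58)] -/
theorem exists_eq_tailMin (n : ℕ) (ω : ℕ → Site 2) :
    ∃ j, lastTop n ω - 1 ≤ j ∧ j ≤ n ∧ ω j 1 = tailMin n ω := by
  obtain ⟨j, hj, h⟩ := Finset.exists_mem_eq_inf'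
    (⟨n, Finset.mem_Icc.2 ⟨by have := (lastTop_spec n ω).1; omega, le_rfl⟩⟩ : (Finset.Icc (lastTop n ω - 1) n).Nonempty)
    fun j => ω j 1
  exact ⟨j, (Finset.mem_Icc.1 hj).1, (Finset.mem_Icc.1 hj).2, h.symm⟩

/-- `tailMin ≤ maxRow`. [cite: MadrasSlade1993, §3.1 (proof of Proposition 3.1.5, p. 58)] -/
theorem tailMin_le_maxRow (n : ℕ) (ω : ℕ → Site 2) : tailMin n ω ≤ maxRow n ω :=
  (tailMin_le ω (by omega : lastTop n ω - 1 ≤ lastTop n ω) (lastTop_spec n ω).1).trans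
    (apply_le_maxRow ω (lastTop_spec n ω).1)

/-- **The depth of the fold**: how far below its top row the walk dips on the folded segment (a natural number).
[cite: MadrasSlade1993, §3.1 (proof of Proposition 3.1.5: the spans A_i)] -/
def depth (n : ℕ) (ω : ℕ → Site 2) : ℕ := (maxRow n ω - tailMin n ω).toNat

/-- `depth = maxRow − tailMin` as integers. [cite: MadrasSlade1993, §3.1 (proof of Proposition 3.1.5, p. 58)] -/
theorem depth_eq (n : ℕ) (ω : ℕ → Site 2) : (depth n ω : ℤ) = maxRow n ω - tailMin n ω := by
  rw [depth, Int.toNat_of_nonneg (sub_nonneg.2 (tailMin_le_maxRow n ω))]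

/-- A walk that does not end on its top row dips: `1 ≤ depth`. [cite: MadrasSlade1993, §3.1 (proof of Proposition 3.1.5)] -/
theorem one_le_depth {n : ℕ} (ω : ℕ → Site 2) (hp : lastTop n ω < n) : 1 ≤ depth n ω := by
  have h := apply_lt_maxRow_of_lastTop_lt ω hp le_rfl
  have h2 := tailMin_le ω (by omega : lastTop n ω - 1 ≤ n) le_rfl
  have := depth_eq n ω
  omega

/-- **The fold raises the top row by exactly `depth + 1`**:
`maxRow (n+1) (rowFold n ω) = maxRow n ω + 1 + depth n ω`. [cite: MadrasSlade1993, §3.1 (proof of Proposition 3.1.5: A₁(ω') = A₁(ω) + A₂(ω))] -/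
theorem maxRow_rowFold_eq {n : ℕ} (ω : ℕ → Site 2) (hp : lastTop n ω < n) :
    maxRow (n + 1) (rowFold n ω) = maxRow n ω + 1 + depth n ω := by
  rw [depth_eq]
  apply le_antisymm
  · -- every row of the fold is `≤ 2m + 1 − tailMin`
    obtain ⟨i, hi, heq⟩ := exists_eq_maxRow (n + 1) (rowFold n ω)
    rw [← heq]
    rcases lt_or_ge i (lastTop n ω) with h | h
    · have := rowFold_row_le ω h
      have := tailMin_le_maxRow n ω
      omega
    · rw [rowFold_row_eq ω h]
      have := tailMin_le ω (by omega : lastTop n ω - 1 ≤ i - 1) (by omega)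
      omega
  · -- attained at (one after) a time where `tailMin` is attained
    obtain ⟨j, hj1, hj2, hj⟩ := exists_eq_tailMin n ω
    have h := apply_le_maxRow (rowFold n ω) (show j + 1 ≤ n + 1 by omega)
    rw [rowFold_row_eq ω (by omega : lastTop n ω ≤ j + 1), Nat.add_sub_cancel, hj] at h
    omega

/-- Every top-row time of the fold lies in the reflected tail, at least `2·depth` after the old pivot:
`lastTop n ω + 2 depth n ω ≤ lastTop (n+1) (rowFold n ω)`. [cite: MadrasSlade1993, §3.1 (proof of Proposition 3.1.5)] -/
theorem lastTop_rowFold_ge {n : ℕ} {ω : ℕ → Site 2} (hω : ω ∈ saws n) (hp : lastTop n ω < n) :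
    lastTop n ω + 2 * depth n ω ≤ lastTop (n + 1) (rowFold n ω) := by
  set p := lastTop n ω with hpdef
  set q := lastTop (n + 1) (rowFold n ω) with hqdef
  obtain ⟨hqn, hqtop⟩ := lastTop_spec (n + 1) (rowFold n ω)
  rw [← hqdef] at hqn hqtop
  rw [maxRow_rowFold_eq ω hp] at hqtop
  have hd := depth_eq n ω
  have hd1 := one_le_depth ω hp
  -- `q` is not in the head (rows `≤ m` there)
  have hq : p ≤ q := by
    by_contra h
    have := rowFold_row_le ω (Nat.lt_of_not_le h)
    omega
  -- so `rowFold … q` is the reflection of `ω (q-1)`, which is at row `tailMin`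
  rw [rowFold_row_eq ω hq] at hqtop
  have hrow : ω (q - 1) 1 = tailMin n ω := by omega
  -- from `ω p` (row `m`) the walk needs `≥ 2 depth − 1` steps to reach row `tailMin = m − depth`
  have hpq : p ≤ q - 1 := by
    by_contra h
    have hq' : q = p := by omega
    -- then `ω (p-1)` is at row `tailMin`, but it is on the top row
    have hspec := lastTop_pred_spec hω hp
    have hrowp : ω (p - 1) 1 = maxRow n ω := by rcases hspec with h' | h' <;> exact h'.2.1
    rw [hq'] at hrow
    omega
  have hdrop := two_mul_row_sub_le hω p (q - 1) hpq (by omega)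
  rw [hrow, (lastTop_spec n ω).2] at hdrop
  -- `2 depth = 2 (m − tailMin) ≤ (q − 1) − p + 1`
  have hcast : ((q - 1 : ℕ) : ℤ) = (q : ℤ) - 1 := by omega
  omega

/-- **The depth strictly decreases**: if the fold of `ω` again does not end on its top row, then
`depth (n+1) (rowFold n ω) < depth n ω` ("`A₁ > A₂ > ⋯`" for the folds across the rows; the honeycomb parity makes
the inequality strict: descending `d` rows costs `≥ 2d − 1` steps, and a depth-one tail that is left again would have
to end the walk). [cite: MadrasSlade1993, §3.1 (proof of Proposition 3.1.5: the spans strictly decrease)] -/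
theorem depth_rowFold_lt {n : ℕ} {ω : ℕ → Site 2} (hω : ω ∈ saws n) (hp : lastTop n ω < n)
    (hp' : lastTop (n + 1) (rowFold n ω) < n + 1) : depth (n + 1) (rowFold n ω) < depth n ω := by
  set p := lastTop n ω with hpdef
  set q := lastTop (n + 1) (rowFold n ω) with hqdef
  set m := maxRow n ω with hmdef
  have hd := depth_eq n ω
  have hd' := depth_eq (n + 1) (rowFold n ω)
  have hd1 := one_le_depth ω hp
  have hmax := maxRow_rowFold_eq ω hp
  have hq := lastTop_rowFold_ge hω hp
  rw [← hpdef, ← hqdef] at hq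
  -- the new folded segment `[q-1, n+1]` lies in the reflected tail (`q − 1 ≥ p`), whose rows are `2m+1 − ω(i−1)₁ ≥ m+1`
  obtain ⟨j, hj1, hj2, hj⟩ := exists_eq_tailMin (n + 1) (rowFold n ω)
  rw [← hqdef] at hj1
  have hjp : p ≤ j := by omega
  rw [rowFold_row_eq ω hjp] at hj
  -- `ω (j-1)` is strictly below the old top row unless `j − 1 ∈ {p−1, p}`
  have hj1' : p + 2 * depth n ω - 1 ≤ j := by omega
  -- case split on whether `ω (j-1)` is on the old top row
  by_cases htop : ω (j - 1) 1 = m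
  · -- then `j − 1 ≤ p`, forcing `depth = 1` and `j − 1 = p`; but then the tail of `ω` after `p` stays in row `m − 1`
    -- and its last visit to that row is at time `n`, so `q = n + 1`: the fold ends on its top row — contradiction.
    exfalso
    have hjle : j - 1 ≤ p := by
      by_contra h
      have := apply_lt_maxRow_of_lastTop_lt ω (show p < j - 1 by omega) (by omega)
      rw [← hmdef] at this; omega
    have hdep : depth n ω = 1 := by omega
    have hjeq : j - 1 = p := by omega
    -- rows of `ω` on `[p, n]` are `≥ m − 1` (tailMin) and `< m` after `p`: so `= m − 1` on `(p, n]`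
    have htm : tailMin n ω = m - 1 := by omega
    have hrown : ω n 1 = m - 1 := by
      have h1 := tailMin_le ω (by omega : p - 1 ≤ n) le_rfl
      have h2 := apply_lt_maxRow_of_lastTop_lt ω hp le_rfl
      rw [← hmdef] at h2; omega
    -- hence `rowFold … (n+1)` is on the new top row, i.e. `q = n + 1`
    have htop' : rowFold n ω (n + 1) 1 = maxRow (n + 1) (rowFold n ω) := by
      rw [rowFold_row_eq ω (by omega : p ≤ n + 1), Nat.add_sub_cancel, hrown, hmax, hd, htm]; ring
    have : n + 1 ≤ q := by
      rw [hqdef, lastTop]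
      exact Finset.le_max' _ _ (Finset.mem_filter.2 ⟨Finset.mem_range.2 (Nat.lt_succ_self _), htop'⟩)
    omega
  · -- `ω (j-1) ≤ m − 1`, so the new tailMin `= 2m+1−ω(j−1)₁ ≥ m + 2` and the new depth `≤ depth − 1`
    have hle : ω (j - 1) 1 ≤ m - 1 := by
      have := apply_le_maxRow ω (show j - 1 ≤ n by omega)
      rw [← hmdef] at this; omega
    have : (depth (n + 1) (rowFold n ω) : ℤ) < depth n ω := by
      rw [hd', hmax, ← hj, hd]; omega
    exact_mod_cast this

end Literature.Probability.RandomPlanarGeometry.SAW.HexBW
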